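import Mathlib
import Literature.Probability.LatticeModels.DiscretePoissonSummation
import Literature.Probability.LatticeModels.TorusCentredLift
import Literature.Analysis.FluidPDE.ScalarFourierFamily
import HarnessLib

/-!
# Route `KLProgramme` — crux K3, child «VolumeLimit»: discrete Poisson summation on `(ℤ/Lℤ)^d`, UNIFORM version — a
# periodized kernel with polynomial decay keeps that decay on the CENTRED fundamental domain, uniformly in the period
# (cell gate-hubbard-kl, seat hubbard-kl-r2d-p2 g2; generic lattice lemmas serving the position-space door
# `…VolumeLimitSiteKernel(Defs)` into the VL slot — `--supports` the VolumeLimit child)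

Continuation of `Literature.Probability.LatticeModels.DiscretePoissonSummation` (the torus kernel
`L^{-d} Σ_k χ_k(z̄) â(k)` is the periodization `Σ_{n ∈ ℤ^d} a(z + Ln)`, Glimm–Jaffe Prop. 7.3.1 on the lattice) and
`TorusCentredLift.lean` (centred representatives `Torus.cRep`, coordinates in `(-L/2, L/2]`).

**The statement.** `DiscretePoissonSummation` gives the finite-size correction `Σ_{n ≠ 0} a(z + Ln)` at a FIXED site
`z` as `L → ∞` (`norm_tsum_translate_sub_le`, `tendsto_tsum_translate`).  For volume-UNIFORM estimates one needs more:
a bound on the periodization valid on the WHOLE centred box `‖z‖_∞ ≤ L/2` with a majorant that is summable in `z` and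
does not depend on `L`.  If the infinite-volume kernel has polynomial decay in the sup norm,
`‖a(x)‖ ≤ C (1 + ‖x‖_∞)^{-K}` (`FourierNS.HasDecay K C a`) with `K` at least the summable order `latOrder d = 2d` of
`ScalarFourierFamily`, then for every period `L ≥ 1` and every site with `2‖z‖_∞ ≤ L`,

  `Σ_{n ∈ ℤ^d} ‖a(z + Ln)‖ ≤ C (1 + 4^K · latMass d) (1 + ‖z‖_∞)^{-K}`

(`tsum_norm_translate_le_of_hasDecay`) — the SAME decay with an `L`-independent constant.  The mechanism is the
elementary inequality `(1 + ‖z‖)(1 + ‖n‖) ≤ 4 (1 + ‖z + Ln‖)` for `n ≠ 0`, `2‖z‖ ≤ L`, `L ≥ 1`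
(`one_add_norm_mul_le_of_centred`: a non-zero image of a centred site is at sup distance `≥ L‖n‖ − L/2 ≥ ‖z‖‖n‖`), which
factorises the decay weight of every non-zero image into the weight of `z` times a summable weight of `n`.

**Consequences** (the use in finite-volume / infinite-volume comparisons of lattice propagators, Benfatto–Giuliani–
Mastropietro 2006 §2.2 fn. 1 «our bounds … turn out to be uniform in L»): the inverse torus Fourier transform of the
grid restriction of `â`, read on centred representatives and extended by `0` — the CENTRED-LIFT kernel
`z ↦ [z = cRep z̄] · L^{-d} Σ_k χ_k(z̄) â(k)` — obeys `HasDecay K (C (1 + 4^K latMass d))` for EVERY `L ≥ 1`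
(`hasDecay_centredLift_torusFourierInv_latticeFourierTorus`), and converges sitewise to `a` as `L → ∞`
(`tendsto_centredLift_torusFourierInv_latticeFourierTorus`; the site is eventually centred, `Torus.cRep_proj_of_mem_box`).
These are exactly the two inputs — an `L`-uniform summable site majorant and per-site limits — under which dominated
convergence passes volume limits through lattice sums (Tannery), for kernels given as grid samples of a fixed symbol.

Everything is PROVED; no definitions.  Mathlib: `pi_norm_le_iff_of_nonneg`, `norm_le_pi_norm`, `Int.norm_eq_abs`,
`hasSum_ite_eq`, `Summable.tsum_le_tsum`.  Tree: `torusFourierInv_latticeFourierTorus_eq_tsum_translate`,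
`summable_norm_translate_zsmul`, `tendsto_tsum_translate`, `Torus.two_mul_natAbs_cRepZ_le`, `Torus.cRep_proj_of_mem_box`,
`ScalarFourier.hasSum_latWeight`, `FourierNS.inv_one_add_norm_pow_anti`.

## References

* J. Glimm, A. Jaffe, *Quantum Physics. A Functional Integral Point of View*, 2nd ed. (Springer 1987), §7.3,
  Prop. 7.3.1. [GlimmJaffeQP1987]
* G. Benfatto, A. Giuliani, V. Mastropietro, Ann. Henri Poincaré 7 (2006) 809–898, §2.2 footnote 1,
  arXiv:cond-mat/0507686 p. 8. [BenfattoGiulianiMastropietro2006]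
-/

noncomputable section

open Finset Filter Complex
open scoped ComplexConjugate Topology

namespace Summit.HubbardSuperconductivity.HubbardSuperconductivity.Theorems.KLRegimeSplit

set_option linter.dupNamespace false -- summit = problem name (single-conjunct summit), D-0017

open Literature.Probability.LatticeModels
open Literature.Analysis.FluidPDE.FourierNS (HasDecay inv_one_add_norm_pow_anti)
open Literature.Analysis.FluidPDE.ScalarFourier (latOrder latMass hasSum_latWeight latMass_nonneg summable_norm_of_hasDecay)

variable {d : ℕ}

/-! ### Sup-norm bookkeeping on `ℤ^d` -/

/-- The scaled vector `L • n` is within `‖z‖` of `z + L • n`: `L ‖n‖ ≤ ‖z + L n‖ + ‖z‖` (coordinatewise triangle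
inequality, then the sup). [folklore] -/
theorem natCast_mul_norm_le_norm_translate_add (L : ℕ) (z n : Site d) :
    (L : ℝ) * ‖n‖ ≤ ‖z + (L : ℤ) • n‖ + ‖z‖ := by
  rcases Nat.eq_zero_or_pos L with hL | hL
  · subst hL
    simp only [Nat.cast_zero, zero_mul, zero_smul, add_zero]
    positivity
  have hLpos : (0 : ℝ) < L := by exact_mod_cast hL
  have hcoord : ∀ i, ‖n i‖ ≤ (‖z + (L : ℤ) • n‖ + ‖z‖) / L := by
    intro i
    rw [le_div_iff₀ hLpos]
    have h1 : ‖(z + (L : ℤ) • n) i‖ ≤ ‖z + (L : ℤ) • n‖ := norm_le_pi_norm _ i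
    have h2 : ‖z i‖ ≤ ‖z‖ := norm_le_pi_norm z i
    have h3 : ((L : ℤ) • n) i = (z + (L : ℤ) • n) i - z i := by simp
    have h4 : ‖((L : ℤ) • n) i‖ = (L : ℝ) * ‖n i‖ := by
      simp only [Pi.smul_apply, smul_eq_mul, Int.norm_eq_abs, Int.cast_mul, Int.cast_natCast, abs_mul,
        Nat.abs_cast]
    have h5 : ‖((L : ℤ) • n) i‖ ≤ ‖(z + (L : ℤ) • n) i‖ + ‖z i‖ := by
      rw [h3]; exact norm_sub_le _ _
    rw [h4] at h5
    linarith
  have h := (pi_norm_le_iff_of_nonneg (by positivity)).2 hcoord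
  rwa [le_div_iff₀ hLpos, mul_comm] at h

/-- **The factorisation inequality.**  For a site `z` in the centred box of period `L ≥ 1` (`2‖z‖ ≤ L`) and a non-zero
image index `n`, `(1 + ‖z‖)(1 + ‖n‖) ≤ 4 (1 + ‖z + L n‖)`. [folklore] -/
theorem one_add_norm_mul_le_of_centred {L : ℕ} (hL : 1 ≤ L) {z : Site d} (hz : 2 * ‖z‖ ≤ L) {n : Site d}
    (hn : n ≠ 0) : (1 + ‖z‖) * (1 + ‖n‖) ≤ 4 * (1 + ‖z + (L : ℤ) • n‖) := by
  -- a non-zero integer vector has sup norm `≥ 1` (`LongRangeIsing.one_le_norm_of_ne_zero`, inlined to keep the imports light)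
  have hn1 : (1 : ℝ) ≤ ‖n‖ := by
    rw [Site.norm_eq_supNorm]
    exact_mod_cast Nat.one_le_iff_ne_zero.2 fun h => hn (Site.supNorm_eq_zero_iff.1 h)
  have hkey := natCast_mul_norm_le_norm_translate_add L z n
  have hL' : (1 : ℝ) ≤ L := by exact_mod_cast hL
  have hz0 : 0 ≤ ‖z‖ := norm_nonneg z
  have hW0 : 0 ≤ ‖z + (L : ℤ) • n‖ := norm_nonneg _
  nlinarith [mul_le_mul_of_nonneg_right hz (by linarith : (0 : ℝ) ≤ ‖n‖ - 1),
    mul_le_mul_of_nonneg_right hL' (by linarith : (0 : ℝ) ≤ ‖n‖)]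

/-- The decay weight of a non-zero image of a centred site factorises:
`(1 + ‖z + Ln‖)^{-K} ≤ 4^K (1 + ‖z‖)^{-K} (1 + ‖n‖)^{-K}`. [folklore] -/
theorem inv_one_add_norm_translate_pow_le {L : ℕ} (hL : 1 ≤ L) {z : Site d} (hz : 2 * ‖z‖ ≤ L) {n : Site d}
    (hn : n ≠ 0) (K : ℕ) :
    ((1 + ‖z + (L : ℤ) • n‖) ^ K)⁻¹ ≤ (4 : ℝ) ^ K * ((1 + ‖z‖) ^ K)⁻¹ * ((1 + ‖n‖) ^ K)⁻¹ := by
  have h := one_add_norm_mul_le_of_centred hL hz hn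
  have hw : 0 < 1 + ‖z + (L : ℤ) • n‖ := by positivity
  have hpow : ((1 + ‖z‖) * (1 + ‖n‖)) ^ K ≤ (4 : ℝ) ^ K * (1 + ‖z + (L : ℤ) • n‖) ^ K := by
    rw [← mul_pow]
    exact pow_le_pow_left₀ (by positivity) h K
  have hpos : 0 < ((1 + ‖z‖) * (1 + ‖n‖)) ^ K := by positivity
  have h4 : (0 : ℝ) < (4 : ℝ) ^ K := by positivity
  calc ((1 + ‖z + (L : ℤ) • n‖) ^ K)⁻¹ = (4 : ℝ) ^ K / ((4 : ℝ) ^ K * (1 + ‖z + (L : ℤ) • n‖) ^ K) := by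
        field_simp
    _ ≤ (4 : ℝ) ^ K / ((1 + ‖z‖) * (1 + ‖n‖)) ^ K := div_le_div_of_nonneg_left (by positivity) hpos hpow
    _ = (4 : ℝ) ^ K * ((1 + ‖z‖) ^ K)⁻¹ * ((1 + ‖n‖) ^ K)⁻¹ := by
        rw [mul_pow]
        field_simp

/-! ### The periodization keeps the decay on the centred box, uniformly in the period -/

/-- **Uniform decay of the periodization on the centred box.**  If `‖a(x)‖ ≤ C (1 + ‖x‖)^{-K}` on `ℤ^d` with
`latOrder d ≤ K`, then for every period `L ≥ 1` and every site with `2‖z‖ ≤ L`,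
`Σ_{n ∈ ℤ^d} ‖a(z + Ln)‖ ≤ C (1 + 4^K latMass d) (1 + ‖z‖)^{-K}`.
(Benfatto–Giuliani–Mastropietro 2006 §2.2 fn. 1: bounds uniform in `L`; Glimm–Jaffe Prop. 7.3.1 for the periodization.)
[cite: BenfattoGiulianiMastropietro2006, §2.2 footnote 1] -/
theorem tsum_norm_translate_le_of_hasDecay {K : ℕ} {C : ℝ} {a : Site d → ℂ} (ha : HasDecay K C a)
    (hK : latOrder (Fin d) ≤ K) {L : ℕ} (hL : 1 ≤ L) {z : Site d} (hz : 2 * ‖z‖ ≤ L) :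
    ∑' n : Site d, ‖a (z + (L : ℤ) • n)‖ ≤ C * (1 + (4 : ℝ) ^ K * latMass (Fin d)) * ((1 + ‖z‖) ^ K)⁻¹ := by
  classical
  haveI : NeZero L := ⟨by omega⟩
  have hC : 0 ≤ C := ha.nonneg
  have hsum : Summable fun n : Site d => ‖a (z + (L : ℤ) • n)‖ :=
    summable_norm_translate_zsmul (summable_norm_of_hasDecay hK ha) z
  -- the termwise majorant
  set g : Site d → ℝ := fun n =>
    C * ((1 + ‖z‖) ^ K)⁻¹ * ((if n = 0 then (1 : ℝ) else 0) + (4 : ℝ) ^ K * ((1 + ‖n‖) ^ latOrder (Fin d))⁻¹) with hg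
  have hgsum : HasSum g (C * ((1 + ‖z‖) ^ K)⁻¹ * (1 + (4 : ℝ) ^ K * latMass (Fin d))) := by
    have h1 : HasSum (fun n : Site d => (if n = 0 then (1 : ℝ) else 0)) 1 := hasSum_ite_eq 0 1
    have h2 : HasSum (fun n : Site d => (4 : ℝ) ^ K * ((1 + ‖n‖) ^ latOrder (Fin d))⁻¹) ((4 : ℝ) ^ K * latMass (Fin d)) :=
      hasSum_latWeight.mul_left _
    exact (h1.add h2).mul_left _
  have hle : ∀ n, ‖a (z + (L : ℤ) • n)‖ ≤ g n := by
    intro n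
    by_cases hn : n = 0
    · subst hn
      simp only [hg, smul_zero, add_zero, if_true]
      have hw : 0 ≤ (4 : ℝ) ^ K * ((1 + ‖(0 : Site d)‖) ^ latOrder (Fin d))⁻¹ := by positivity
      calc ‖a z‖ ≤ C * ((1 + ‖z‖) ^ K)⁻¹ := ha z
        _ = C * ((1 + ‖z‖) ^ K)⁻¹ * 1 := by ring
        _ ≤ C * ((1 + ‖z‖) ^ K)⁻¹ * (1 + (4 : ℝ) ^ K * ((1 + ‖(0 : Site d)‖) ^ latOrder (Fin d))⁻¹) :=
          mul_le_mul_of_nonneg_left (by linarith) (by positivity)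
    · simp only [hg, hn, if_false, zero_add]
      have hfac := inv_one_add_norm_translate_pow_le hL hz hn K
      have hanti : ((1 + ‖n‖) ^ K)⁻¹ ≤ ((1 + ‖n‖) ^ latOrder (Fin d))⁻¹ := inv_one_add_norm_pow_anti n hK
      calc ‖a (z + (L : ℤ) • n)‖ ≤ C * ((1 + ‖z + (L : ℤ) • n‖) ^ K)⁻¹ := ha _
        _ ≤ C * ((4 : ℝ) ^ K * ((1 + ‖z‖) ^ K)⁻¹ * ((1 + ‖n‖) ^ K)⁻¹) := mul_le_mul_of_nonneg_left hfac hC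
        _ ≤ C * ((4 : ℝ) ^ K * ((1 + ‖z‖) ^ K)⁻¹ * ((1 + ‖n‖) ^ latOrder (Fin d))⁻¹) :=
          mul_le_mul_of_nonneg_left (mul_le_mul_of_nonneg_left hanti (by positivity)) hC
        _ = C * ((1 + ‖z‖) ^ K)⁻¹ * ((4 : ℝ) ^ K * ((1 + ‖n‖) ^ latOrder (Fin d))⁻¹) := by ring
  calc ∑' n : Site d, ‖a (z + (L : ℤ) • n)‖ ≤ ∑' n, g n := hsum.tsum_le_tsum hle hgsum.summable
    _ = C * ((1 + ‖z‖) ^ K)⁻¹ * (1 + (4 : ℝ) ^ K * latMass (Fin d)) := hgsum.tsum_eq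
    _ = C * (1 + (4 : ℝ) ^ K * latMass (Fin d)) * ((1 + ‖z‖) ^ K)⁻¹ := by ring

/-- The periodization itself (not only its absolute series) obeys the uniform bound on the centred box. [folklore] -/
theorem norm_tsum_translate_le_of_hasDecay {K : ℕ} {C : ℝ} {a : Site d → ℂ} (ha : HasDecay K C a)
    (hK : latOrder (Fin d) ≤ K) {L : ℕ} (hL : 1 ≤ L) {z : Site d} (hz : 2 * ‖z‖ ≤ L) :
    ‖∑' n : Site d, a (z + (L : ℤ) • n)‖ ≤ C * (1 + (4 : ℝ) ^ K * latMass (Fin d)) * ((1 + ‖z‖) ^ K)⁻¹ := by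
  haveI : NeZero L := ⟨by omega⟩
  exact (norm_tsum_le_tsum_norm (summable_norm_translate_zsmul (summable_norm_of_hasDecay hK ha) z)).trans
    (tsum_norm_translate_le_of_hasDecay ha hK hL hz)

/-! ### The centred-lift torus kernel: uniform decay and sitewise limits -/

/-- A centred representative lies in the centred box: `2‖cRep u‖ ≤ L`. [folklore] -/
theorem two_mul_norm_cRep_le {L : ℕ} [NeZero L] (u : TorusSite d L) : 2 * ‖Torus.cRep u‖ ≤ (L : ℝ) := by
  have h : ∀ i, ‖Torus.cRep u i‖ ≤ (L : ℝ) / 2 := by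
    intro i
    rw [Int.norm_eq_abs, le_div_iff₀ (by norm_num : (0 : ℝ) < 2)]
    have h1 := Torus.two_mul_natAbs_cRepZ_le (u i)
    have h2 : (2 * (Torus.cRepZ (u i)).natAbs : ℝ) ≤ L := by exact_mod_cast h1
    have h3 : |((Torus.cRepZ (u i) : ℤ) : ℝ)| = ((Torus.cRepZ (u i)).natAbs : ℝ) := by
      rw [← Int.cast_abs, ← Int.natCast_natAbs, Int.cast_natCast]
    simp only [Torus.cRep]
    rw [h3]; linarith
  have := (pi_norm_le_iff_of_nonneg (by positivity)).2 h
  linarith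

/-- **Uniform decay of the centred-lift torus kernel.**  For `a` with `HasDecay K C a`, `latOrder d ≤ K`, and every period
`L ≥ 1`, the inverse torus Fourier transform of the grid restriction `â|_{(ℤ/Lℤ)^d}`, read on centred representatives and
extended by `0`, has decay `K` with the `L`-INDEPENDENT constant `C (1 + 4^K latMass d)`.
[cite: BenfattoGiulianiMastropietro2006, §2.2 footnote 1] -/
theorem hasDecay_centredLift_torusFourierInv_latticeFourierTorus {K : ℕ} {C : ℝ} {a : Site d → ℂ}
    (ha : HasDecay K C a) (hK : latOrder (Fin d) ≤ K) {L : ℕ} [NeZero L] (hL : 1 ≤ L) :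
    HasDecay K (C * (1 + (4 : ℝ) ^ K * latMass (Fin d)))
      (fun z : Site d => if Torus.cRep (Torus.proj L z) = z then torusFourierInv (latticeFourierTorus L a) (Torus.proj L z)
        else 0) := by
  intro z
  have hC : 0 ≤ C * (1 + (4 : ℝ) ^ K * latMass (Fin d)) :=
    mul_nonneg ha.nonneg (by have := latMass_nonneg (d := Fin d); positivity)
  by_cases hz : Torus.cRep (Torus.proj L z) = z
  · simp only [hz, if_true]
    have hz2 : 2 * ‖z‖ ≤ (L : ℝ) := by
      have h := two_mul_norm_cRep_le (Torus.proj L z)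
      rwa [hz] at h
    rw [torusFourierInv_latticeFourierTorus_eq_tsum_translate (summable_norm_of_hasDecay hK ha) z]
    exact norm_tsum_translate_le_of_hasDecay ha hK hL hz2
  · simp only [hz, if_false, norm_zero]
    positivity

/-- **Sitewise limit of the centred-lift torus kernel**: at every fixed site `z`, the centred-lift kernel of period `L` tends
to `a(z)` as `L → ∞` (the site is eventually centred, and the periodization tends to `a(z)`: `tendsto_tsum_translate`).
[folklore] -/
theorem tendsto_centredLift_torusFourierInv_latticeFourierTorus {a : Site d → ℂ} (ha : Summable fun x => ‖a x‖)
    (z : Site d) :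
    Tendsto (fun L : ℕ => if hL : L = 0 then (0 : ℂ) else
      haveI : NeZero L := ⟨hL⟩
      if Torus.cRep (Torus.proj L z) = z then torusFourierInv (latticeFourierTorus L a) (Torus.proj L z) else 0)
      atTop (𝓝 (a z)) := by
  -- `z` lies in the box of radius `M = ‖z‖_∞`, which is centred once `2M < L`
  set M : ℕ := Finset.univ.sup fun i => (z i).natAbs with hM
  have hzM : z ∈ box d M := by
    rw [mem_box]
    intro i
    have h : (z i).natAbs ≤ M := Finset.le_sup (f := fun i => (z i).natAbs) (Finset.mem_univ i)
    constructor <;> omega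
  refine (tendsto_tsum_translate ha z).congr' ?_
  filter_upwards [eventually_gt_atTop (2 * M)] with L hL
  have hL0 : L ≠ 0 := by omega
  haveI : NeZero L := ⟨hL0⟩
  rw [dif_neg hL0, if_pos (Torus.cRep_proj_of_mem_box hL hzM),
    torusFourierInv_latticeFourierTorus_eq_tsum_translate ha z]

end Summit.HubbardSuperconductivity.HubbardSuperconductivity.Theorems.KLRegimeSplit

end
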